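import Literature.MathematicalPhysics.QuantumFieldTheory.Balaban1983to89.B11Ineq88KernelLettersCompositeLatticeFree
import Literature.MathematicalPhysics.QuantumFieldTheory.Balaban1983to89.B11Eq88LaplaceH1CurrentNorm
import Literature.MathematicalPhysics.QuantumFieldTheory.Balaban1983to89.B11Eq88LaplaceH1CurrentSymmetry
import Literature.MathematicalPhysics.QuantumFieldTheory.Balaban1983to89.B11Eq98W80Composite
import Literature.MathematicalPhysics.QuantumFieldTheory.Balaban1983to89.B11Ineq73KernelLettersUniform

/-!
# `Balaban1983to89.B11Ineq98W80CompositeLatticeFree` — T. Bałaban, *The variational problem and background fields in renormalization group method for lattice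
gauge theories*, Commun. Math. Phys. **102** (1985) 277–309 [Balaban1985Variational], Proposition 4 (97)–(98) pp. 292–293 «The functional derivative of V(A′) is
an analytic function on this space, and satisfies the estimate |((δ/δA′)V)(A′)| < C₄ε₃²(Lʲη)⁻³ on Ω_j … The constants a₃, C₄ depend on d and L only», with
(87)–(88) p. 291 «⟨A′, Δ_π HD(A′)⟩ = ⟨A′, (Δ_U + DRD*)HD(A′)⟩ (87) … Applying the inequalities (3.132) from [5], (55), (73) … we can estimate this functional
derivative by O(1)ε₁(Lʲη)⁻³ on Ω_j»: **PROPOSITION 4 FOR THE TYPED `W = (δ/δA′)V` (`W80`) WITH THE CONCRETE LETTER `Δ_π := currentCLM φ lev₁ Dc (Δ̃_{a,k} −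
Q_k†aQ_k)` (print's `Δ_π + DRD*`) AND A LATTICE-FREE `(C₄, R′)` ON PRINT's CLASS — NO OPERATOR NORM `‖Δ_π‖`** — `B11Eq98W80Composite.quadAnalytic_W80_composite`
at the chain's `H = H̃_{1,k}`, `C = C_k`, its binders `hsym` (`B11Eq88LaplaceH1CurrentSymmetry`), `hN₁` (`B11Eq88LaplaceH1CurrentNorm`), `hΘE`, `hΘ3`, `hΘ′`
(`B11Ineq88KernelLettersCompositeLatticeFree`) DISCHARGED lattice-free; the remaining letters DISPLAYED as lattice-free numbers (`M_ρ`, the V₀-group's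
`(C_V, R_V)`, `M_J`, the weight-ratio ∕ profile letters `ϖ, ϖ′, ω₃, Ω_B`, the radius `R′`) — the replacement of this lineage's `B11Ineq98W80LatticeFree` whose
letter `M_Δ = ‖Δ_π‖_{(1,2)→(−3)} ≳ η⁻¹` was NOT lattice-free (memo `LOCATED-after-g97.md` §2 (E′))

statement-level skeleton of published theorems with citation tags; proofs where landed; nothing here is a claim about the Yang–Mills mass gap

CITATION HEADER (lean-in-tree rule).  Audit cell `pub-balaban`, sub-cell `t4`, BINDER row NE9; NE9 crux-team LEAF PROVER 01 (`b2b-balaban-t4-ne9-formalise-leaf-01`,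
gen 98; bears_on: R4/N22), step (E′)(3c) of the lineage memo.  Composition BY NAME: `exists_kernelLetters_composite_latticeFree`, `exists_norm_current_laplaceH1_le`,
`pairSum_current_laplaceAkPi_sub_QaQ_comm`, `B11Eq98W80Composite.quadAnalytic_W80_composite`, `B11Eq44CLetterTower.prop4Hyp_Cck`,
`B11Ineq73KernelLettersUniform.quadAnalytic_mono_const`.  Sources read through the audited headers of those files (`paper:balaban1985-cmp102-variational-background`
pp. 289–293; `paper:balaban1985-cmp99-background-propagators` pp. 392, 419–422).  Nothing of print's proof reproduced; no constant of print valued.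

WHAT IS PROVED (sorry-free; proof lane — no `def`).  **`exists_quadAnalytic_W80_composite_latticeFree`**: `∃ α₁ j₁ B δ B₁ δ₁` BEFORE (K81)'s binder block VERBATIM
through `hQ` (`(B, δ)` = the unified kernel letter of `B11Ineq88KernelLettersCompositeLatticeFree`, `(B₁, δ₁)` = the row letter of `B11Eq88LaplaceH1CurrentNorm`), then
for every level profile ∕ carrier data, [4] Prop. 2's data of `C_k` with Prop. 5's radius `ρ′`, every Sect. C regime `Regime H̃_{1,k} 0 C_k b 0 (C2T d α₀) ρ′ 0 a_C ε_C`
with `0 < a_C`, `ε_C + a_C ≤ ρ′`, weight-ratio bounds `ϖ, ϖ′`, the window `(ε_C + a_C)ΘΓ ≤ ½`, the unitarity of the level backgrounds `Ū^j(b)⋆ = Ū^j(b)⁻¹`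
(print's class; it makes `Δ̃_{a,k} − Q_k†aQ_k` symmetric for the trace pairing), and the displayed W-slot letters (`0 ≤ C_V`, `0 < R_V`, `M_ρ, M_J ≥ 0`,
`0 < R′ ≤ a_C`, `R′ ≤ (1 − 4bC₂(ε_C + a_C))R_V`, `‖ρ‖ ≤ M_ρ`, the V₀-slot at `(C_V, R_V)` for the trace functional `τ`, `‖J‖ ≤ M_J`, profile letters
`w̄₃ ≤ ω₃`, `w̲_B⁻¹ ≤ Ω_B`): `QuadAnalytic (W80 ρ τ U₀ H̃_{1,k} C_k ε_C J Δ_π) C₄ᶜ R′ ∧ AnalyticOnNhd ℂ (W80 …) {‖Y‖ < R′}` with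
`Δ_π = currentCLM φ lev₁ Dc (Δ̃_{a,k} − Q_k†∘(aQ_k))`, `C₄ᶜ = M_ρC_τθ₃M_J + (NC₂ℓ² + M_ρC_τθ_E′) + M_ρC_τθ_E·NC₂ℓ²·R′ + M_ρC_τ(1 + θ_ER′)C_Vℓ²`, `θ_E = 2ϖΘΓℓ`,
`θ₃ = (2ℓ + 1)ϖΘΓ/a_C`, `θ_E′ = 2ϖ′ΘΓℓ`, `N = ω₃·(M_φB₁M_φ′·dK_d(δ₁))·Ω_B`, `Θ = M_φBM_φ′·d·K_d(δ)`, `Γ = C₃·2^d·2d`, `ℓ = (1 − 4bC₂(ε_C + a_C))⁻¹` — every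
letter lattice-free.
HONEST SCOPE.  (i) The letters `M_J` (print's current window × profile), `C_V` (`B11Eq98V0LettersLatticeUniform`), `M_ρ`, the weight ∕ profile letters and the
regime's numerics stay DISPLAYED; feeding the chart's W-slot is the consumer's business (Support sequel).  (ii) Constants crude; NOT print's `C₄(d, L)` valued; `θ₃ ∝ a_C⁻¹`
(Schwarz radius).  (iii) NOT summit progress (cell pub-balaban: NE9 NOT PRINTED ∕ NOT PROVED; «NE9 ⇐ the named binders»; row WALLED ON A MODEL (O-NE9-1; #5 UNRULED);
spine PROVED 0∕9; rung (B)+1 on a finite T⁴ — NOT infinite volume, NOT mass gap, NOT BetaPertH, NOT Clay; HONEST DEPENDENCY: continuum YM on T⁴ ⇐ BetaPertH ∧ nine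
spine estimates (0/9 proved); BetaPertH ⇐ (D1) ∧ (D4) ∧ CAP+tail; G-an2-4 gates asym, D1 and NE2/3/4).  NEW file; nothing modified.  Net new unproved facts: 0.
-/

noncomputable section

set_option autoImplicit false

open scoped InnerProductSpace ComplexConjugate BigOperators

namespace Literature.MathematicalPhysics.QuantumFieldTheory.Balaban1983to89.B11Ineq98W80CompositeLatticeFree

open B4Sect5Torus (TSite tdist tdist_nonneg tdist_symm tdist_self tdist_triangle torusSum_le)
open B4Sect5Proof (latticeConst latticeConst_nonneg)
open B9SectCLatticeCarrier (Bond DirPair bpos btgt shift unshift)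
open B9Eq311L2Pairing (WL2)
open B9Eq319QprimeTorus (fineP blockCoord)
open B7Prop1Explicit (U1 Wcx boxVec)
open B11Eq103H1Complex (SiteL2K BondL2K greenK covDerivL2K covDivL2K G1LatticeK KinvLatticeK H1LatticeK H1LatticeK_eq)
open B9Eq310DeltaPrime (plaqHolU)
open B9Eq310HessianOperator (adTransportW hessOp)
open B9Eq310HessianHermitian (adTransportW_adjoint)
open B9Eq315QTorus (perCfg cornerSite)
open B9Eq315QTower (towerP UlevOf)
open B9Eq316TowerFlatIsOneStep (towerP_eq_fineP_pow siteCast)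
open B9Eq326OperatorTower (QprimeTowerW QkW RofUk laplaceAk G1k)
open B9Eq324DeltaPrimeATower (laplacePrimeAk GpOfUk)
open B9Eq33CovDerivLocalLetterTower (tdist_bigBlock_bpos_btgt_le_one)
open B9Eq3117GaugeModeStencilLettersTower (local_hessOp_covDerivL2K_tower local_covDivL2K_hessOp_tower)
open B9Eq3130GtildePairRowsClosedTower (exists_local_letters_G1LatticeKPi)
open B9Eq3132QGtildeQInvLetterClosed (exists_local_letter_KinvLatticeKPi)
open B9Eq3119DeltaPiTower (piOfUk laplaceAkPi)

open B9Eq3126H1kPiSupRowClosed (exists_local_letter_H1LatticeKPi)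
open B9Eq326LocalPartTowerSupDecayDiagonalClosed (sum_bondMass_bigBlock_le)
open B11Eq103H1Complex (H1LatticeCLM H1CLM_apply funEquiv funEquiv_symm_apply)
open B11Eq115Space

open B9Eq3126H1kPiOneBlockColumn (exists_oneBlock_letter_H1LatticeCLM sum_fine_exp_block_le sum_fine_weight_exp_block_le)
open B11Eq103H1Complex (H1LatticeCLM)
open B11Eq115Space
open B11Prop6Scheme (Prop4Hyp)
open B11Eq174Chart (Regime)
open B11Eq90Transpose (kernel single115)
open B11Eq90V0primeCurrent (flat115 flat115_apply)
open B11Eq80Current (Emap E3)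
open B11Eq44COperatorTower (C2T)
open B11Eq44CLetterTower (Cck prop4Hyp_Cck)
open B11Eq44CKernelColumnTower (norm_fderiv_Cck_single_apply_le)
open B7Eq141TorusImagesCount (sum_images_kerQdd_le)
open B7Prop2Explicit (pdev AvgClosed C0 c2')
open B7Prop3Flat (c3)
open B7Prop5GeneralLevels (thetaGen C3Gen)
open B7Prop5GeneralOperators (kerQdd kerQdd_nonneg)
open B9Eq315QTorusOnto (liftSite periodVec)
open B11Eq73KernelColumnsCarrier (colSum_weighted_kernel_fderiv_Emap_le)
open B11Rem289KernelColumnsTheta3 (colSum_weighted_kernel_fderiv_E3_le)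

open B11Ineq88KernelLettersCompositeLatticeFree (exists_kernelLetters_composite_latticeFree)
open B11Eq88LaplaceH1CurrentNorm (exists_norm_current_laplaceH1_le)
open B11Eq88LaplaceH1CurrentSymmetry (pairSum_current_laplaceAkPi_sub_QaQ_comm)
open B9Eq3119DeltaPiCarrier (currentCLM)
open B13Contraction113 (QuadAnalytic)
open B11Eq80Current (W80)
open B11Eq63V0GroupCurrent (curV0)
open B11Eq98W80Composite (quadAnalytic_W80_composite)
open B11Ineq73KernelLettersUniform (quadAnalytic_mono_const)
open Metric Set


variable {d : ℕ} (hd : 1 ≤ d) (L : ℕ) [NeZero L] (hL : 1 ≤ L) (hL3 : 3 ≤ L)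
  {𝔸 : Type*} [NormedRing 𝔸] [NormedAlgebra ℂ 𝔸] [CompleteSpace 𝔸] [NormOneClass 𝔸] [StarRing 𝔸] [NormedStarGroup 𝔸] [StarModule ℂ 𝔸]
  {W : Type*} [NormedAddCommGroup W] [InnerProductSpace ℂ W] [FiniteDimensional ℂ W] (φ : W ≃ₗ[ℂ] 𝔸)
  {Mφ Mφ' : ℝ} (hMφ : 0 ≤ Mφ) (hMφ' : 0 ≤ Mφ') (hφ : ∀ w, ‖φ w‖ ≤ Mφ * ‖w‖) (hφ' : ∀ X, ‖φ.symm X‖ ≤ Mφ' * ‖X‖) (hstar : ∀ X : 𝔸, ‖star X‖ ≤ ‖X‖)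
  {a : ℝ} (ha : 0 < a) {a' : ℝ} (ha' : 0 < a') {ϱ : ℝ} (hϱ0 : 0 ≤ ϱ) (hϱ1 : ϱ < 1)
  (τ : 𝔸 →ₗ[ℂ] ℂ) {Cτ : ℝ} (hτ : ∀ X, ‖τ X‖ ≤ Cτ * ‖X‖) (hCτ : 0 ≤ Cτ) {Mτ : ℝ} (hτm : ∀ X Y : 𝔸, ‖τ (X * Y)‖ ≤ Mτ * ‖X‖ * ‖Y‖) (hMτ : 0 ≤ Mτ)
  {ρw : ℝ} (hρw : 0 ≤ ρw)
  (hτ₁ : ∀ X : 𝔸, τ (star X) = conj (τ X)) (hτ₂ : ∀ X Y : 𝔸, τ (X * Y) = τ (Y * X)) (hφτ : ∀ X Y : 𝔸, ⟪φ.symm X, φ.symm Y⟫_ℂ = τ (star X * Y))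
  (AQ : ℝ)




set_option maxRecDepth 8192 in
set_option maxHeartbeats 3200000 in -- (K81)'s ≈ 50-binder block + the `C_k` block + the W-slot letters + the composite constant
include hd hL hL3 hMφ hMφ' hφ hφ' hstar ha ha' hϱ0 hϱ1 hτ hCτ hτm hMτ hρw hτ₁ hτ₂ hφτ in
/-- **PROPOSITION 4 FOR `W80` WITH THE CONCRETE `Δ_π` AND A LATTICE-FREE `(C₄, R′)` ON PRINT's CLASS** («|((δ/δA′)V)(A′)|₍₋₃₎ ≦ C₄(max{{|A′|₍₋₁₎,
|∇A′|₍₋₂₎}})², (98) … The constants a₃, C₄ depend on d and L only»): for the chain's `H = H̃_{1,k}`, `C = C_k`, `Δ_π = currentCLM φ lev₁ Dc (Δ̃_{a,k} − Q_k†∘(aQ_k))`,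
`∃ (α₁, j₁, B, δ, B₁, δ₁)` BEFORE the lattice, then — under (K81)'s data of `H̃_{1,k}`, [4] Prop. 2's data of `C_k` with Prop. 5's radius `ρ′`, a Sect. C regime
`Regime H 0 C b 0 C₂ ρ′ 0 a_C ε_C` with `ε_C + a_C ≤ ρ′`, the window `(ε_C + a_C)ΘΓ ≤ ½`, unitary level backgrounds, and the W-slot's DISPLAYED letters (the
V₀-group's slot `(C_V, R_V)`, `M_ρ`, `M_J`, the weight ∕ profile letters `ϖ, ϖ′, ω₃, Ω_B`, a radius `0 < R′ ≤ a_C`, `R′ ≤ (1 − 4bC₂(ε_C + a_C))R_V`) — BOTH W-slot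
clauses: `QuadAnalytic (W80 …) C₄ᶜ R′ ∧ AnalyticOnNhd ℂ (W80 …) {{‖Y‖ < R′}}` with `C₄ᶜ = M_ρC_τθ₃M_J + (NC₂ℓ² + M_ρC_τθ_E′) + M_ρC_τθ_E·NC₂ℓ²·R′ +
M_ρC_τ(1 + θ_ER′)C_Vℓ²`, `θ_E = 2ϖΘΓℓ`, `θ₃ = (2ℓ + 1)ϖΘΓ/a_C`, `θ_E′ = 2ϖ′ΘΓℓ`, `N = ω₃·(M_φB₁M_φ′·dK_d(δ₁))·Ω_B`, `Θ = M_φBM_φ′·d·K_d(δ)`, `Γ = C₃·2^d·2d` —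
every letter lattice-free, NO operator norm of `Δ_π`.
[cite: Balaban1985Variational, Prop. 4 (97)–(98) pp.292–293, (73) p.289, (86)–(89) p.291; Balaban1985Averaging, Prop. 5 (157) p.42; Balaban1985BackgroundPropagators, (3.119) p.419, (3.122) p.420, (3.126) p.420, (3.132) p.422] -/
theorem exists_quadAnalytic_W80_composite_latticeFree :
    ∃ α₁ j₁ B δ B₁ δ₁ : ℝ, 0 < α₁ ∧ 0 < j₁ ∧ 0 ≤ B ∧ 0 < δ ∧ 0 ≤ B₁ ∧ 0 < δ₁ ∧
      ∀ (n : ℕ) (η : ℝ) (_hηL : η * (L : ℝ) ^ (n + 1) = 1) (c₀ c₁ : ℝ) [Fact (0 < c₀)] [Fact (0 < c₁)]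
        (_hw : c₀ * ((L : ℝ) ^ (n + 1)) ^ d = c₁) (_hρ : |η| ^ d / c₀ ≤ ρw) (m : Fin d → ℕ) [∀ i, NeZero (m i)] (_hm : ∀ i, 1 ≤ m i)
        (U : Bond d (towerP L m (n + 1)) → 𝔸ˣ) (αU : ℕ → ℝ) (_hα0 : ∀ j, 0 ≤ αU j) (hα1 : ∀ j, αU j ≤ 1 / 64)
        (hαL : ∀ j, 50 * (d + 1) * αU j * (L : ℝ) ^ d ≤ 1 / 2)
        (hU1 : ∀ (j : ℕ) (x : B7Prop1Explicit.Site d) (k : Fin d), perCfg (towerP L m (j + 1)) (UlevOf L m (n + 1) U j) x k ∈ U1 𝔸)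
        (hreg : ∀ (j : ℕ) (y : TSite d (towerP L m j)) (k : Fin d) (ρ' : Fin d → Fin L),
          ‖((Wcx L (perCfg (towerP L m (j + 1)) (UlevOf L m (n + 1) U j)) (cornerSite L y) k (boxVec L ρ') : 𝔸ˣ) : 𝔸) - 1‖ ≤ αU j)
        (εU : ℕ → ℝ) (_hεU : ∀ j, 0 ≤ εU j) (_hUε : ∀ (j : ℕ) (b : Bond d (towerP L m (j + 1))), ‖(UlevOf L m (n + 1) U j b : 𝔸) - 1‖ ≤ εU j)
        (_hLb : ∀ (j : ℕ) (b : Bond d (towerP L m (j + 1))), UlevOf L m (n + 1) U j b ∈ U1 𝔸)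
        (α : ℝ) (_hα : 0 ≤ α) (_hαle : α ≤ α₁)
        (hUst : ∀ b, star (U b : 𝔸) = (((U b)⁻¹ : 𝔸ˣ) : 𝔸)) (_hUb : ∀ b, U b ∈ U1 𝔸) (_hUη : ∀ b, ‖(U b : 𝔸) - 1‖ ≤ α * η)
        (_hpl : ∀ p : B9SectCLatticeCarrier.Plaq d (towerP L m (n + 1)), ‖(plaqHolU U p : 𝔸) - 1‖ ≤ α * η ^ 2)
        (_hUgrad : ∀ (x : TSite d (towerP L m (n + 1))) (μ : Fin d), ‖(U (x, μ) : 𝔸) - U (unshift μ x, μ)‖ ≤ α * η ^ 2)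
        (_hRlev : ∀ (j : ℕ) (b : Bond d (towerP L m (j + 1))) (w : W), ‖adTransportW φ (UlevOf L m (n + 1) U j) b w‖ ≤ ‖w‖)
        (_hεg : ∀ j < n + 1, εU j ≤ α * ϱ ^ j) (_hAQ : ∑ j ∈ Finset.range (n + 1), αU j ≤ AQ)
        (hpos' : ∀ x : SiteL2K ℂ d (towerP L m (n + 1)) c₀ W, x ≠ 0 → 0 < RCLike.re ⟪x, laplacePrimeAk L m n φ η U a' (c₁ := c₁) x⟫_ℂ)
        (hpos : ∀ x : BondL2K ℂ d (towerP L m (n + 1)) c₀ W, x ≠ 0 →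
          0 < RCLike.re ⟪x, laplaceAk L m n φ η U hL αU hα1 hU1 hreg τ (c₀ := c₀) (c₁ := c₁) a x⟫_ℂ)
        (_hc₀η : c₀ = η ^ d) (j₀ : ℝ) (_hJ : ∀ μ y, ‖B9Eq39Adjoint.J (fun μ => B9Eq33CovDerivVector.shiftEquiv μ) (fun μ y => U (y, μ)) η μ y‖ ≤ j₀) (_hj : j₀ ≤ j₁)
        (hposπ : ∀ x : BondL2K ℂ d (towerP L m (n + 1)) c₀ W, x ≠ 0 →
          0 < RCLike.re ⟪x, laplaceAkPi L m n φ τ η U a' hpos' hL αU hα1 hU1 hreg (c₁ := c₁) a x⟫_ℂ)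
        (hQ : Function.Surjective (QkW L m n φ U hL αU hα1 hU1 hreg (c₀ := c₀) (c₁ := c₁)))
        [FiniteDimensional ℂ 𝔸] (lev₀ : Bond d (towerP L m (n + 1)) → ℕ) {κ' : Type*} [Fintype κ'] (lev₁ : κ' → ℕ)
        (Dc : (Bond d (towerP L m (n + 1)) → 𝔸) →ₗ[ℂ] (κ' → 𝔸)) (levB : Bond d m → ℕ) [Fact (0 < (L : ℝ))] [Fact (0 < η)]
        -- the `C_k`-side data ([4] Prop. 2 on `U`, the levels, the radius `ρ′` of Prop. 5's regime)
        (hL2 : 2 ≤ L) {Gr : Subgroup 𝔸ˣ} (_hGr : AvgClosed d L Gr) (_hUG : ∀ (x : B7Prop1Explicit.Site d) (κ : Fin d), perCfg (towerP L m (n + 1)) U x κ ∈ Gr)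
        {α₀ : ℝ} (_hα₀ : 0 < α₀) (_hα3 : C0 d * α₀ ≤ 1 / 3) (_hα4 : 4 * α₀ ≤ c2' d L)
        (_h52 : pdev (perCfg (towerP L m (n + 1)) U) < α₀ * (((L : ℝ) ^ (n + 1))⁻¹) ^ 2) (_hlev : ∀ b, n + 1 ≤ lev₀ b) {ρ' : ℝ}
        (_hρ' : Real.exp (4 * (800 * ((d : ℝ) + 1) ^ 2 * ((d : ℝ) + 4)) * α₀) * (1 + 8 * (131072 * ((d : ℝ) + 1) ^ 2) * ρ') ≤ 2)
        (_hρ'4 : 4 * ρ' ≤ c3 d L) (_hθ : 2 * d * thetaGen d L α₀ ≤ (L : ℝ) ^ 3 / 16) (_hC3 : 2 * d * C3Gen d L * ρ' ≤ 1)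
        -- the Sect. C regime of the pair `(H̃_{1,k}, C_k)`, the weight ratios and the window of the kernel route
        {b aC εC : ℝ} (_RC : Regime (H1LatticeCLM (L := (L : ℝ)) (η := η) (lev₀ := lev₀) (levB := levB) φ hposπ hQ lev₁ Dc) 0
          (Cck L m η (n + 1) U lev₀ lev₁ Dc levB) b 0 (C2T d α₀) ρ' 0 aC εC)
        (_haC : 0 < aC) (_hεa : εC + aC ≤ ρ') {ϖ : ℝ} (_hϖ0 : 0 ≤ ϖ)
        (_hϖ : ∀ bb b' : Bond d (towerP L m (n + 1)), levWeight (L : ℝ) η lev₀ 3 bb / levWeight (L : ℝ) η lev₀ 3 b' ≤ ϖ) {ϖ' : ℝ} (_hϖ'0 : 0 ≤ ϖ')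
        (_hϖ' : ∀ bb b' : Bond d (towerP L m (n + 1)), levWeight (L : ℝ) η lev₀ 3 bb / levWeight (L : ℝ) η lev₀ 1 b' ≤ ϖ')
        (_hq : (εC + aC) * (Mφ * B * Mφ' * (d * latticeConst d δ)) * (C3Gen d L * (2 ^ d * (2 * d))) ≤ 1 / 2)
        -- print's class: the level backgrounds are unitary (the symmetry of `Δ̃_{a,k} − Q_k†aQ_k` for the trace pairing)
        (_hUlev : ∀ (j : ℕ) (bb : Bond d (towerP L m (j + 1))), star (UlevOf L m (n + 1) U j bb : 𝔸) = ((UlevOf L m (n + 1) U j bb)⁻¹ : 𝔸ˣ))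
        -- the W-slot's displayed letters: the V₀-group's slot, the fibre map `ρ`, the current `J`, the profile letters, the radius
        {CV RV Mρ MJ ω₃ ΩB : ℝ} (_hCV : 0 ≤ CV) (_hRV : 0 < RV) (_hMρ : 0 ≤ Mρ) (_hMJ : 0 ≤ MJ)
        (_hω₃ : (NegSup.wSup (levWeight (L : ℝ) η lev₀ 3) : ℝ) ≤ ω₃) (_hΩB : (NegSup.wInvSup (levWeight (L : ℝ) η levB 0) : ℝ) ≤ ΩB)
        {R' : ℝ} (_hR'0 : 0 < R') (_hR'a : R' ≤ aC) (_hR'V : R' ≤ (1 - 4 * b * C2T d α₀ * (εC + aC)) * RV)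
        (ρ : (𝔸 →L[ℂ] ℂ) →L[ℂ] 𝔸) (U₀ : Bond d (towerP L m (n + 1)) → 𝔸ˣ) (_hρn : ‖ρ‖ ≤ Mρ)
        (_hqV : ∀ Y : Space115 (L : ℝ) η lev₀ lev₁ Dc, ‖Y‖ < RV →
          ‖curV0 (lev₁ := lev₁) (Dc := Dc) ρ (LinearMap.toContinuousLinearMap τ) U₀ Y‖ ≤ CV * ‖Y‖ ^ 2)
        (J : NegSize (L : ℝ) η lev₀ 3 𝔸) (_hJ : ‖J‖ ≤ MJ),
        QuadAnalytic (W80 ρ (LinearMap.toContinuousLinearMap τ) U₀ (H1LatticeCLM (L := (L : ℝ)) (η := η) (lev₀ := lev₀) (levB := levB) φ hposπ hQ lev₁ Dc)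
            (Cck L m η (n + 1) U lev₀ lev₁ Dc levB) εC J
            (currentCLM φ lev₁ Dc
              (laplaceAkPi L m n φ τ η U a' hpos' hL αU hα1 hU1 hreg (c₁ := c₁) a
                - LinearMap.adjoint (QkW L m n φ U hL αU hα1 hU1 hreg (c₀ := c₀) (c₁ := c₁)) ∘ₗ
                    ((a : ℂ) • QkW L m n φ U hL αU hα1 hU1 hreg (c₀ := c₀) (c₁ := c₁)))))
          (Mρ * Cτ * ((2 * (1 / (1 - 4 * b * C2T d α₀ * (εC + aC))) + 1) * (ϖ * (Mφ * B * Mφ' * (d * latticeConst d δ))) * (C3Gen d L * (2 ^ d * (2 * d))) / aC) * MJ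
            + ((ω₃ * (Mφ * B₁ * Mφ' * (d * latticeConst d δ₁)) * ΩB) * C2T d α₀ * (1 / (1 - 4 * b * C2T d α₀ * (εC + aC))) ^ 2
                + Mρ * Cτ * (2 * (ϖ' * (Mφ * B * Mφ' * (d * latticeConst d δ))) * (C3Gen d L * (2 ^ d * (2 * d))) * (1 / (1 - 4 * b * C2T d α₀ * (εC + aC)))))
            + Mρ * Cτ * (2 * (ϖ * (Mφ * B * Mφ' * (d * latticeConst d δ))) * (C3Gen d L * (2 ^ d * (2 * d))) * (1 / (1 - 4 * b * C2T d α₀ * (εC + aC))))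
                * ((ω₃ * (Mφ * B₁ * Mφ' * (d * latticeConst d δ₁)) * ΩB) * C2T d α₀ * (1 / (1 - 4 * b * C2T d α₀ * (εC + aC))) ^ 2) * R'
            + Mρ * Cτ * (1 + (2 * (ϖ * (Mφ * B * Mφ' * (d * latticeConst d δ))) * (C3Gen d L * (2 ^ d * (2 * d))) * (1 / (1 - 4 * b * C2T d α₀ * (εC + aC)))) * R')
                * CV * (1 / (1 - 4 * b * C2T d α₀ * (εC + aC))) ^ 2) R' ∧
        AnalyticOnNhd ℂ (W80 ρ (LinearMap.toContinuousLinearMap τ) U₀ (H1LatticeCLM (L := (L : ℝ)) (η := η) (lev₀ := lev₀) (levB := levB) φ hposπ hQ lev₁ Dc)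
            (Cck L m η (n + 1) U lev₀ lev₁ Dc levB) εC J
            (currentCLM φ lev₁ Dc
              (laplaceAkPi L m n φ τ η U a' hpos' hL αU hα1 hU1 hreg (c₁ := c₁) a
                - LinearMap.adjoint (QkW L m n φ U hL αU hα1 hU1 hreg (c₀ := c₀) (c₁ := c₁)) ∘ₗ
                    ((a : ℂ) • QkW L m n φ U hL αU hα1 hU1 hreg (c₀ := c₀) (c₁ := c₁)))))
          {Y : Space115 (L : ℝ) η lev₀ lev₁ Dc | ‖Y‖ < R'} := by
  obtain ⟨α₁, j₁, B, δ, hα₁, hj₁, hB, hδ, HΘ⟩ :=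
    exists_kernelLetters_composite_latticeFree hd L hL hL3 φ hMφ hMφ' hφ hφ' hstar ha ha' hϱ0 hϱ1 τ hτ hCτ hτm hMτ hρw hτ₁ hτ₂ hφτ AQ
  obtain ⟨α₁', j₁', B₁, δ₁, hα₁', hj₁', hB₁, hδ₁, HN⟩ :=
    exists_norm_current_laplaceH1_le hd L hL hL3 φ hMφ hMφ' hφ hφ' hstar ha ha' hϱ0 hϱ1 τ hτ hCτ hτm hMτ hρw hτ₁ hτ₂ hφτ AQ
  refine ⟨min α₁ α₁', min j₁ j₁', B, δ, B₁, δ₁, lt_min hα₁ hα₁', lt_min hj₁ hj₁', hB, hδ, hB₁, hδ₁, ?_⟩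
  intro n η hηL c₀ c₁ _ _ hw hρ m _ hm U αU hα0 hα1 hαL hU1 hreg εU hεU hUε hLb α hα hαle hUst hUb hUη hpl hUgrad hRlev hεg hAQ hpos' hpos hc₀η j₀ hJ hj
    hposπ hQ _ lev₀ κ' _ lev₁ Dc levB _ _ hL2 Gr hGr hUG α₀ hα₀ hα3 hα4 h52 hlev ρ' hρ' hρ'4 hθ hC3 b aC εC RC haC hεa ϖ hϖ0 hϖ ϖ' hϖ'0 hϖ' hq hUlev
    CV RV Mρ MJ ω₃ ΩB hCV hRV hMρ hMJ hω₃ hΩB R' hR'0 hR'a hR'V ρ U₀ hρn hqV J hJn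
  have hαK : α ≤ α₁ := hαle.trans (min_le_left _ _)
  have hαN : α ≤ α₁' := hαle.trans (min_le_right _ _)
  have hj' : j₀ ≤ j₁ := hj.trans (min_le_left _ _)
  have hj'' : j₀ ≤ j₁' := hj.trans (min_le_right _ _)
  obtain ⟨hΘE, hΘ3, hΘ'⟩ := HΘ n η hηL c₀ c₁ hw hρ m hm U αU hα0 hα1 hαL hU1 hreg εU hεU hUε hLb α hα hαK hUst hUb hUη hpl hUgrad hRlev hεg hAQ hpos' hpos hc₀η
    j₀ hJ hj' hposπ hQ lev₀ lev₁ Dc levB hL2 hGr hUG hα₀ hα3 hα4 h52 hlev hρ' hρ'4 hθ hC3 RC haC hεa hϖ0 hϖ hϖ'0 hϖ' hq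
  have hK0 : 0 ≤ latticeConst d δ := latticeConst_nonneg d hδ.le
  have hK1 : 0 ≤ latticeConst d δ₁ := latticeConst_nonneg d hδ₁.le
  have hC30 : 0 ≤ C3Gen d L := by unfold C3Gen B7Prop5GeneralLevels.C1ppGen; positivity
  have h1q : 0 < 1 - 4 * b * C2T d α₀ * (εC + aC) := by linarith [RC.contr]
  have hC2 : 0 ≤ C2T d α₀ := RC.C₄_nonneg
  have hω₃0 : 0 ≤ ω₃ := (NNReal.coe_nonneg _).trans hω₃
  have hΩB0 : 0 ≤ ΩB := (NNReal.coe_nonneg _).trans hΩB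
  have hθE : 0 ≤ 2 * (ϖ * (Mφ * B * Mφ' * (d * latticeConst d δ))) * (C3Gen d L * (2 ^ d * (2 * d))) * (1 / (1 - 4 * b * C2T d α₀ * (εC + aC))) := by
    positivity
  have hθE' : 0 ≤ 2 * (ϖ' * (Mφ * B * Mφ' * (d * latticeConst d δ))) * (C3Gen d L * (2 ^ d * (2 * d))) * (1 / (1 - 4 * b * C2T d α₀ * (εC + aC))) := by
    positivity
  have hθ₃ : 0 ≤ (2 * (1 / (1 - 4 * b * C2T d α₀ * (εC + aC))) + 1) * (ϖ * (Mφ * B * Mφ' * (d * latticeConst d δ))) * (C3Gen d L * (2 ^ d * (2 * d))) / aC := by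
    positivity
  have hN0 : 0 ≤ ω₃ * (Mφ * B₁ * Mφ' * (d * latticeConst d δ₁)) * ΩB := by positivity
  have hC : Prop4Hyp (Cck L m η (n + 1) U lev₀ lev₁ Dc levB) (C2T d α₀) ρ' :=
    prop4Hyp_Cck L m η (n + 1) U lev₀ lev₁ Dc levB hL2 hGr hUG hα₀ hα3 hα4 h52 hlev hρ' (by linarith [RC.ε₄_nonneg])
  -- the composite row letter `N₁ ≤ ω₃·(M_φB₁M_φ′·dK_d(δ₁))·Ω_B`
  have hN₁ : ∀ X : NegSize (L : ℝ) η levB 0 𝔸,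
      ‖currentCLM φ lev₁ Dc
          (laplaceAkPi L m n φ τ η U a' hpos' hL αU hα1 hU1 hreg (c₁ := c₁) a
            - LinearMap.adjoint (QkW L m n φ U hL αU hα1 hU1 hreg (c₀ := c₀) (c₁ := c₁)) ∘ₗ
                ((a : ℂ) • QkW L m n φ U hL αU hα1 hU1 hreg (c₀ := c₀) (c₁ := c₁)))
          (H1LatticeCLM (L := (L : ℝ)) (η := η) (lev₀ := lev₀) (levB := levB) φ hposπ hQ lev₁ Dc X)‖ ≤
        ω₃ * (Mφ * B₁ * Mφ' * (d * latticeConst d δ₁)) * ΩB * ‖X‖ := fun X => by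
    refine (HN n η hηL c₀ c₁ hw hρ m hm U αU hα0 hα1 hαL hU1 hreg εU hεU hUε hLb α hα hαN hUst hUb hUη hpl hUgrad hRlev hεg hAQ hpos' hpos hc₀η
      j₀ hJ hj'' hposπ hQ lev₀ lev₁ Dc levB X).trans ?_
    have h0 : 0 ≤ Mφ * B₁ * Mφ' * (d * latticeConst d δ₁) := by positivity
    gcongr
  -- the trace functional's norm
  have hτn : ‖LinearMap.toContinuousLinearMap τ‖ ≤ Cτ :=
    ContinuousLinearMap.opNorm_le_bound _ hCτ fun X => by simpa only [LinearMap.coe_toContinuousLinearMap'] using hτ X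
  -- the (27)-symmetry of the concrete `Δπ`
  have hsym := pairSum_current_laplaceAkPi_sub_QaQ_comm L m n φ τ η hUlev hUst hφτ hτ₁ hτ₂ a' hpos' hL αU hα1 hU1 hreg (Lr := (L : ℝ)) (lev₀ := lev₀)
    lev₁ Dc a
  obtain ⟨hq98, han⟩ := quadAnalytic_W80_composite ρ (LinearMap.toContinuousLinearMap τ) U₀ hCV hqV RC hC J _ hsym hθ₃ hθE hθE' hN0 hR'0.le hR'a hR'V
    hN₁ (fun A' hA' bb => hΘE A' (lt_of_lt_of_le hA' hR'a) bb) (fun A' hA' bb X => hΘ' A' (lt_of_lt_of_le hA' hR'a) bb X)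
    (fun A' hA' bb => hΘ3 A' (lt_of_lt_of_le hA' hR'a) bb)
  refine ⟨quadAnalytic_mono_const hq98 ?_, han⟩
  gcongr

end Literature.MathematicalPhysics.QuantumFieldTheory.Balaban1983to89.B11Ineq98W80CompositeLatticeFree

end
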